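import Literature.AlgebraicGeometry.Morphisms.RigidityLemma
import HarnessLib

/-!
# Crux `NoZenoR` (stmt-ResolutionOfSingularities-19943) — LOCAL DESCENT of a morphism along a proper Stein morphism that
# contracts a fibre (the local half of the section-free rigidity / blow-down descent)

Route `ResolutionOfSingularities/HomologicalConductor` (cell decomp-res, hand leafhand-res-homologicalconduct-18 g1).
OURS: AI-written proof over Mathlib/tree lemmas, weaker than expert review; nothing here is a statement of the manuscript
under review (Hironaka 2017).  SUPPORT level, counted 0.  Def-free, no new named facts.

What Lipman's proof of (27.3) (p. 278, ¶2) still needs in this tree, besides the intersection-number exercise, is the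
DESCENT of an `S`-morphism `q : W′ → X` along a point blow-down `τ : W′ → W₁` when `q` contracts the exceptional curve:
`q = τ ≫ q₁`.  The tree's rigidity lemma (`Morphisms.eq_comp_of_forall_fibre_const_of_stein`) needs a SECTION of `τ`;
a blow-down has none.  This file proves the section-free LOCAL form — everything except the final gluing:

* `exists_appTop_eq` — between affine schemes every ring map `Γ(V) → Γ(U)` is `g.appTop` for some `g : U → V`;
* `exists_fac_of_isIso_appTop` — if `p : T → U` induces an isomorphism `Γ(U) ⥲ Γ(T)` (Stein) and `U`, `V` are affine,
  every `ψ : T → V` factors UNIQUELY-SHAPED as `ψ = p ≫ g`;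
* `exists_affineOpen_preimage_le` — the tube lemma (`Morphisms.isOpen_setOf_fiber_subset`): for `p` closed and an open
  `W ⊇ p⁻¹(s)`, an affine open `U ∋ s` with `p⁻¹(U) ⊆ W`;
* **`exists_local_fac_of_stein`** — for `p : X → S` universally closed contracting the fibre over `s` under `f : X → Y`
  (`p x = s ⇒ f x = y`) and Stein over the affine opens around `s` (`(p ∣_ U).appTop` an isomorphism), there are an
  affine open `U ∋ s` and `g : U → Y` with `(p ∣_ U) ≫ g = p⁻¹(U) ↪ X → Y`.

Left for the global statement: glue `g` with `f ∘ p⁻¹` over the locus where `p` is an isomorphism.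
No crux or summit statement is proved here.
-/

noncomputable section

-- single-problem summit: the doubled namespace component `ResolutionOfSingularities` is forced
set_option linter.dupNamespace false

open CategoryTheory AlgebraicGeometry TopologicalSpace Topology
open Literature.AlgebraicGeometry.Morphisms

universe u

namespace Summit.ResolutionOfSingularities.ResolutionOfSingularities.Theorems.NoZeno.FirstKind

/-- **Morphisms between affine schemes with prescribed global sections map**: for `U`, `V` affine and
`φ : Γ(V) → Γ(U)` there is `g : U → V` with `g.appTop = φ` (namely `U ≅ Spec Γ(U) → Spec Γ(V) ≅ V`). [folklore] -/
theorem exists_appTop_eq {U V : Scheme.{u}} [IsAffine U] [IsAffine V] (φ : Γ(V, ⊤) ⟶ Γ(U, ⊤)) :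
    ∃ g : U ⟶ V, g.appTop = φ := by
  refine ⟨U.isoSpec.hom ≫ Spec.map φ ≫ V.isoSpec.inv, ?_⟩
  have hV : V.isoSpec.inv.appTop ≫ (Scheme.ΓSpecIso Γ(V, ⊤)).hom = 𝟙 _ := by
    rw [← Scheme.toSpecΓ_appTop, ← Scheme.isoSpec_hom, ← Scheme.Hom.comp_appTop, Iso.hom_inv_id,
      Scheme.Hom.id_appTop]
  rw [Scheme.Hom.comp_appTop, Scheme.Hom.comp_appTop, Scheme.isoSpec_hom, Scheme.toSpecΓ_appTop,
    Category.assoc, Scheme.ΓSpecIso_naturality, ← Category.assoc, hV, Category.id_comp]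

/-- **Factoring through a Stein morphism into an affine scheme**: `p : T → U` with `p.appTop : Γ(U) → Γ(T)` an
isomorphism, `U` and `V` affine ⇒ every `ψ : T → V` is `p ≫ g` for some `g : U → V` (morphisms into an affine scheme
are determined by their global sections, Mathlib `ext_of_isAffine`). [folklore] -/
theorem exists_fac_of_isIso_appTop {T U V : Scheme.{u}} [IsAffine U] [IsAffine V] (p : T ⟶ U) [IsIso p.appTop]
    (ψ : T ⟶ V) : ∃ g : U ⟶ V, p ≫ g = ψ := by
  obtain ⟨g, hg⟩ := exists_appTop_eq (ψ.appTop ≫ inv p.appTop)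
  refine ⟨g, ext_of_isAffine ?_⟩
  rw [Scheme.Hom.comp_appTop, hg, Category.assoc, IsIso.inv_hom_id, Category.comp_id]

/-- **Tube lemma, affine form**: for `p : X → S` with closed underlying map, a point `s` and an open `W ⊆ X` containing
the fibre `p⁻¹(s)`, there is an affine open `U ∋ s` with `p⁻¹(U) ⊆ W` (`Morphisms.isOpen_setOf_fiber_subset`).
[cite: MumfordFogartyKirwan1994, Ch. 6 §1 Proposition 6.1 (proof)] -/
theorem exists_affineOpen_preimage_le {X S : Scheme.{u}} (p : X ⟶ S) (hp : IsClosedMap p.base) (W : X.Opens)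
    {s : S} (hs : ∀ x : X, p.base x = s → x ∈ W) :
    ∃ U : S.Opens, IsAffineOpen U ∧ s ∈ U ∧ p ⁻¹ᵁ U ≤ W := by
  have hA := isOpen_setOf_fiber_subset p hp W
  obtain ⟨U, hU, hsU, hUA⟩ :=
    exists_isAffineOpen_mem_and_subset (X := S) (x := s) (U := ⟨_, hA⟩) hs
  exact ⟨U, hU, hsU, fun x hx => hUA hx x rfl⟩

/-- **LOCAL DESCENT along a fibre-contracting universally closed Stein morphism.**  Let `p : X → S` be universally
closed, `f : X → Y` any morphism with `f(p⁻¹ s) = {y}`, and suppose `(p ∣_ U).appTop` is an isomorphism for every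
affine open `U ∋ s` (Stein; e.g. `p` proper birational onto a normal `S`).  Then on some affine open `U ∋ s` the
morphism `f` descends: there is `g : U → Y` with `(p ∣_ U) ≫ g = p⁻¹(U) ↪ X → Y`.  (Pick an affine `V ∋ y`, the tube
`U` with `p⁻¹U ⊆ f⁻¹V`, and factor `p⁻¹U → V` through `Γ(V) → Γ(p⁻¹U) ≅ Γ(U)`.)
[cite: MumfordFogartyKirwan1994, Ch. 6 §1 Proposition 6.1 (pp. 115–116)] -/
theorem exists_local_fac_of_stein {X S Y : Scheme.{u}} (p : X ⟶ S) [UniversallyClosed p] (f : X ⟶ Y) {s : S}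
    {y : Y} (hcontr : ∀ x : X, p.base x = s → f.base x = y)
    (hStein : ∀ U : S.Opens, IsAffineOpen U → s ∈ U → IsIso (p ∣_ U).appTop) :
    ∃ U : S.Opens, IsAffineOpen U ∧ s ∈ U ∧
      ∃ g : (U : Scheme.{u}) ⟶ Y, (p ∣_ U) ≫ g = (p ⁻¹ᵁ U).ι ≫ f := by
  obtain ⟨V, hV, hyV, -⟩ := exists_isAffineOpen_mem_and_subset (X := Y) (x := y) (U := ⊤) (Opens.mem_top y)
  obtain ⟨U, hU, hsU, hUle⟩ := exists_affineOpen_preimage_le p p.isClosedMap (f ⁻¹ᵁ V)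
    (fun x hx => show f.base x ∈ V by rw [hcontr x hx]; exact hyV)
  haveI : IsAffine (U : Scheme.{u}) := hU
  haveI : IsAffine (V : Scheme.{u}) := hV
  haveI := hStein U hU hsU
  have hrange : Set.range ((p ⁻¹ᵁ U).ι ≫ f).base ⊆ Set.range V.ι.base := by
    rw [Scheme.Opens.range_ι]
    rintro _ ⟨x, rfl⟩
    rw [Scheme.Hom.comp_apply]
    exact hUle x.2
  obtain ⟨g, hg⟩ := exists_fac_of_isIso_appTop (p ∣_ U) (IsOpenImmersion.lift V.ι ((p ⁻¹ᵁ U).ι ≫ f) hrange)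
  refine ⟨U, hU, hsU, g ≫ V.ι, ?_⟩
  rw [← Category.assoc, hg, IsOpenImmersion.lift_fac]

end Summit.ResolutionOfSingularities.ResolutionOfSingularities.Theorems.NoZeno.FirstKind

end
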